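import Mathlib.Analysis.Calculus.BumpFunction.Basic
import Mathlib.Topology.MetricSpace.ProperSpace
import Summits.RiemannHypothesis.RiemannHypothesis.Theorems.RuelleBandCofiniteCriticalLineStubBranchesContinuousAux
import HarnessLib

/-!
# Stub `stub_branchesContinuous` (line `cofinite-weil-index-staircase`), auxiliary file 2:
the unit `L²`-sphere of a finite span and the min–max levels

Helper file for the crux `RuelleBand.CofiniteCriticalLine` (item stmt-RiemannHypothesis-2064),
stub `stub_branchesContinuous`.  With the dictionary of the line (written out, no definitions)
* `Inner(g) = {Re Q(∑ cᵢ gᵢ) : ∫ ‖∑ cᵢ gᵢ‖² = 1}` for a tuple `g : Fin (k+1) → ℝ → ℂ`,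
* `Outer(a, k) = {sSup Inner(g) : g linearly independent window-a test functions}`,
* `level a k = sInf Outer(a, k)` (the `k`-th Courant–Fischer level of the window form),
this file proves: for linearly independent test functions `g` the coefficient ellipsoid
`{c | ∫ ‖∑ cᵢ gᵢ‖² = 1}` is compact and nonempty, so `Inner(g)` is nonempty and bounded above;
`Outer(a, k)` is bounded below (Bombieri's lower bound `bddBelow_weilQuadratic_sphere`) and
nonempty for `a > 0` (`k + 1` disjoint bumps); and the resulting `csInf`/`csSup` bookkeeping
lemmas, together with the transfer of `sSup Inner` under Bombieri's dilation.
-/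

set_option linter.dupNamespace false

noncomputable section

open Complex MeasureTheory Filter Set
open scoped BigOperators Topology ComplexConjugate

namespace Summit.RiemannHypothesis.RiemannHypothesis.Theorems.RuelleBandCofiniteCriticalLine

open Literature.NumberTheory.LFunctions

/-! ## The coefficient ellipsoid of a linearly independent tuple -/

/-- For linearly independent test functions, a non-zero combination has positive `L²` norm
(a test function with `∫ ‖f‖² = 0` vanishes identically). [folklore] -/
theorem stub_branchesContinuous_integral_norm_sq_pos {k : ℕ} {g : Fin (k + 1) → ℝ → ℂ}
    (hg : ∀ i, IsWeilTest (g i)) (hli : LinearIndependent ℂ g) {c : Fin (k + 1) → ℂ}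
    (hc : c ≠ 0) : 0 < ∫ t, ‖∑ i, c i * g i t‖ ^ 2 := by
  have hnn : 0 ≤ ∫ t, ‖∑ i, c i * g i t‖ ^ 2 := integral_nonneg fun _ => by positivity
  refine hnn.lt_of_ne fun h0 => hc ?_
  have hf : IsWeilTest (fun t => ∑ i, c i * g i t) :=
    stub_branchesContinuous_isWeilTest_comb _ c fun i _ => hg i
  have hzero := hf.eq_zero_of_integral_norm_sq_eq_zero h0.symm
  rw [Fintype.linearIndependent_iff] at hli
  funext i
  refine hli c ?_ i
  funext x
  have hx := congr_fun hzero x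
  simpa [Finset.sum_apply, smul_eq_mul] using hx

/-- **The coefficient ellipsoid `{c | ∫ ‖∑ cᵢ gᵢ‖² = 1}` of a linearly independent tuple of test
functions is compact**: closed as a level set of a continuous function, bounded because
`∫ ‖∑ cᵢ gᵢ‖² ≥ m ‖c‖²` with `m > 0` the minimum over the unit sphere of the coefficient space.
[folklore] -/
theorem stub_branchesContinuous_isCompact_ellipsoid {k : ℕ} {g : Fin (k + 1) → ℝ → ℂ}
    (hg : ∀ i, IsWeilTest (g i)) (hli : LinearIndependent ℂ g) :
    IsCompact {c : Fin (k + 1) → ℂ | ∫ t, ‖∑ i, c i * g i t‖ ^ 2 = (1 : ℝ)} := by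
  obtain ⟨N, hN⟩ : ∃ N : (Fin (k + 1) → ℂ) → ℝ, N = fun c => ∫ t, ‖∑ i, c i * g i t‖ ^ 2 :=
    ⟨_, rfl⟩
  have hNc : Continuous N := hN ▸ stub_branchesContinuous_continuous_integral_norm_sq hg
  have hset : {c : Fin (k + 1) → ℂ | ∫ t, ‖∑ i, c i * g i t‖ ^ 2 = (1 : ℝ)} = {c | N c = 1} := by
    rw [hN]
  rw [hset]
  have hclosed : IsClosed {c : Fin (k + 1) → ℂ | N c = 1} := isClosed_eq hNc continuous_const
  -- the minimum of `N` on the unit sphere of the coefficient space is positive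
  have hsph : (Metric.sphere (0 : Fin (k + 1) → ℂ) 1).Nonempty :=
    ⟨fun _ => 1, by rw [mem_sphere_zero_iff_norm, pi_norm_const, norm_one]⟩
  obtain ⟨c₀, hc₀, hmin⟩ := (isCompact_sphere (0 : Fin (k + 1) → ℂ) 1).exists_isMinOn hsph
    hNc.continuousOn
  have hc₀ne : c₀ ≠ 0 := by
    rintro rfl
    rw [mem_sphere_zero_iff_norm, norm_zero] at hc₀
    exact zero_ne_one hc₀
  have hm : 0 < N c₀ := by
    rw [hN]
    exact stub_branchesContinuous_integral_norm_sq_pos hg hli hc₀ne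
  have hhom : ∀ (r : ℂ) (c : Fin (k + 1) → ℂ), N (r • c) = ‖r‖ ^ 2 * N c := by
    intro r c
    rw [hN]
    exact stub_branchesContinuous_integral_norm_sq_smul Finset.univ r c g
  have hbound : ∀ c : Fin (k + 1) → ℂ, N c = 1 → ‖c‖ ^ 2 * N c₀ ≤ 1 := by
    intro c hc1
    by_cases hc0 : c = 0
    · rw [hc0, norm_zero]
      simp
    · have hnorm : 0 < ‖c‖ := norm_pos_iff.2 hc0
      have hu : ((‖c‖⁻¹ : ℝ) : ℂ) • c ∈ Metric.sphere (0 : Fin (k + 1) → ℂ) 1 := by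
        rw [mem_sphere_zero_iff_norm, norm_smul, Complex.norm_real, norm_inv, norm_norm,
          inv_mul_cancel₀ hnorm.ne']
      have hle : N c₀ ≤ N (((‖c‖⁻¹ : ℝ) : ℂ) • c) := hmin hu
      rw [hhom, hc1, mul_one, Complex.norm_real, norm_inv, norm_norm] at hle
      calc ‖c‖ ^ 2 * N c₀ ≤ ‖c‖ ^ 2 * ‖c‖⁻¹ ^ 2 := mul_le_mul_of_nonneg_left hle (sq_nonneg _)
        _ = 1 := by field_simp
  have hbdd : Bornology.IsBounded {c : Fin (k + 1) → ℂ | N c = 1} := by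
    rw [Metric.isBounded_iff_subset_closedBall 0]
    refine ⟨Real.sqrt (1 / N c₀), fun c hc => ?_⟩
    rw [mem_closedBall_zero_iff]
    have h1 : ‖c‖ ^ 2 ≤ 1 / N c₀ := by
      rw [le_div_iff₀ hm]
      exact hbound c hc
    calc ‖c‖ = Real.sqrt (‖c‖ ^ 2) := (Real.sqrt_sq (norm_nonneg c)).symm
      _ ≤ Real.sqrt (1 / N c₀) := Real.sqrt_le_sqrt h1
  exact Metric.isCompact_of_isClosed_isBounded hclosed hbdd

/-- The coefficient ellipsoid of a linearly independent tuple of test functions is nonempty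
(normalise the first basis vector). [folklore] -/
theorem stub_branchesContinuous_ellipsoid_nonempty {k : ℕ} {g : Fin (k + 1) → ℝ → ℂ}
    (hg : ∀ i, IsWeilTest (g i)) (hli : LinearIndependent ℂ g) :
    ∃ c : Fin (k + 1) → ℂ, ∫ t, ‖∑ i, c i * g i t‖ ^ 2 = (1 : ℝ) := by
  obtain ⟨c₁, hc₁⟩ : ∃ c₁ : Fin (k + 1) → ℂ, c₁ = fun _ => 1 := ⟨_, rfl⟩
  have hc₁ne : c₁ ≠ 0 := by
    intro h
    have := congr_fun h 0
    rw [hc₁] at this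
    exact one_ne_zero this
  have hpos := stub_branchesContinuous_integral_norm_sq_pos hg hli hc₁ne
  obtain ⟨M, hM⟩ : ∃ M : ℝ, M = ∫ t, ‖∑ i, c₁ i * g i t‖ ^ 2 := ⟨_, rfl⟩
  rw [← hM] at hpos
  refine ⟨(((Real.sqrt M)⁻¹ : ℝ) : ℂ) • c₁, ?_⟩
  rw [stub_branchesContinuous_integral_norm_sq_smul Finset.univ _ c₁ g, ← hM, Complex.norm_real,
    norm_inv, Real.norm_of_nonneg (Real.sqrt_nonneg _), inv_pow, Real.sq_sqrt hpos.le,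
    inv_mul_cancel₀ hpos.ne']

/-- **`Inner(g)` is bounded above** for linearly independent test functions `g`: it is the image
of the compact coefficient ellipsoid under the continuous `c ↦ Re Q(∑ cᵢ gᵢ)`. [folklore] -/
theorem stub_branchesContinuous_inner_bddAbove {k : ℕ} {g : Fin (k + 1) → ℝ → ℂ}
    (hg : ∀ i, IsWeilTest (g i)) (hli : LinearIndependent ℂ g) :
    BddAbove {y : ℝ | ∃ c : Fin (k + 1) → ℂ,
      ∫ t, ‖∑ i, c i * g i t‖ ^ 2 = (1 : ℝ) ∧
      y = (weilQuadratic (fun t => ∑ i, c i * g i t)).re} := by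
  obtain ⟨B, hB⟩ := (stub_branchesContinuous_isCompact_ellipsoid hg hli).bddAbove_image
    (stub_branchesContinuous_continuous_re_weilQuadratic hg).continuousOn
  refine ⟨B, ?_⟩
  rintro y ⟨c, hc, rfl⟩
  exact hB ⟨c, hc, rfl⟩

/-- Elements of `Inner(g)` are bounded by `sSup Inner(g)`. [folklore] -/
theorem stub_branchesContinuous_re_le_sSup {k : ℕ} {g : Fin (k + 1) → ℝ → ℂ}
    (hg : ∀ i, IsWeilTest (g i)) (hli : LinearIndependent ℂ g) {c : Fin (k + 1) → ℂ}
    (hc : ∫ t, ‖∑ i, c i * g i t‖ ^ 2 = (1 : ℝ)) :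
    (weilQuadratic (fun t => ∑ i, c i * g i t)).re ≤
      sSup {y : ℝ | ∃ c : Fin (k + 1) → ℂ,
        ∫ t, ‖∑ i, c i * g i t‖ ^ 2 = (1 : ℝ) ∧
        y = (weilQuadratic (fun t => ∑ i, c i * g i t)).re} :=
  le_csSup (stub_branchesContinuous_inner_bddAbove hg hli) ⟨c, hc, rfl⟩

/-- A bound valid on the whole coefficient ellipsoid bounds `sSup Inner(g)` (the ellipsoid is
nonempty). [folklore] -/
theorem stub_branchesContinuous_sSup_le {k : ℕ} {g : Fin (k + 1) → ℝ → ℂ}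
    (hg : ∀ i, IsWeilTest (g i)) (hli : LinearIndependent ℂ g) {B : ℝ}
    (hB : ∀ c : Fin (k + 1) → ℂ, ∫ t, ‖∑ i, c i * g i t‖ ^ 2 = (1 : ℝ) →
      (weilQuadratic (fun t => ∑ i, c i * g i t)).re ≤ B) :
    sSup {y : ℝ | ∃ c : Fin (k + 1) → ℂ,
        ∫ t, ‖∑ i, c i * g i t‖ ^ 2 = (1 : ℝ) ∧
        y = (weilQuadratic (fun t => ∑ i, c i * g i t)).re} ≤ B := by
  obtain ⟨c₀, hc₀⟩ := stub_branchesContinuous_ellipsoid_nonempty hg hli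
  refine csSup_le ⟨_, c₀, hc₀, rfl⟩ ?_
  rintro y ⟨c, hc, rfl⟩
  exact hB c hc

/-! ## The outer set: bounded below, nonempty for positive windows -/

/-- **`Outer(a, k)` is bounded below** (by Bombieri's lower bound of `Re Q` on the unit sphere of
the window, `bddBelow_weilQuadratic_sphere`): each `sSup Inner(g)` dominates an element of
`Inner(g)`, which lies on that sphere. [folklore] -/
theorem stub_branchesContinuous_outer_bddBelow :
    ∀ (k : ℕ) (a : ℝ), BddBelow {x : ℝ | ∃ g : Fin (k + 1) → ℝ → ℂ,
        (∀ i, IsWeilTest (g i) ∧ tsupport (g i) ⊆ Set.Icc (-a) a) ∧ LinearIndependent ℂ g ∧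
        x = sSup {y : ℝ | ∃ c : Fin (k + 1) → ℂ,
          ∫ t, ‖∑ i, c i * g i t‖ ^ 2 = (1 : ℝ) ∧
          y = (weilQuadratic (fun t => ∑ i, c i * g i t)).re}} := by
  intro k a
  obtain ⟨C, hC⟩ := bddBelow_weilQuadratic_sphere_holds a
  refine ⟨C, ?_⟩
  rintro x ⟨g, hg, hli, rfl⟩
  have hg1 : ∀ i, IsWeilTest (g i) := fun i => (hg i).1
  obtain ⟨c, hc⟩ := stub_branchesContinuous_ellipsoid_nonempty hg1 hli
  have hf : IsWeilTest (fun t => ∑ i, c i * g i t) :=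
    stub_branchesContinuous_isWeilTest_comb _ c fun i _ => hg1 i
  have hfs : tsupport (fun t => ∑ i, c i * g i t) ⊆ Icc (-a) a :=
    stub_branchesContinuous_tsupport_comb_subset _ c fun i _ => (hg i).2
  have h1 : C ≤ (weilQuadratic (fun t => ∑ i, c i * g i t)).re := hC ⟨_, hf, hfs, hc, rfl⟩
  exact h1.trans (stub_branchesContinuous_re_le_sSup hg1 hli hc)

/-- **`Outer(a, k)` is nonempty for `a > 0`**: `k + 1` smooth bumps with pairwise disjoint
supports inside `(0, a)` (centres `x_i = (i+1) a/(k+2)`, outer radius `a/(2(k+2))`), made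
complex; linear independence by evaluation at the centres. [folklore] -/
theorem stub_branchesContinuous_exists_linearIndependent {a : ℝ} (ha : 0 < a) (k : ℕ) :
    ∃ g : Fin (k + 1) → ℝ → ℂ,
      (∀ i, IsWeilTest (g i) ∧ tsupport (g i) ⊆ Set.Icc (-a) a) ∧ LinearIndependent ℂ g := by
  obtain ⟨d, hd⟩ : ∃ d : ℝ, d = a / ((k : ℝ) + 2) := ⟨_, rfl⟩
  have hd0 : 0 < d := by rw [hd]; positivity
  have hda : d * ((k : ℝ) + 2) = a := by rw [hd]; field_simp
  obtain ⟨x, hx⟩ : ∃ x : Fin (k + 1) → ℝ, x = fun i : Fin (k + 1) => d * (((i : ℕ) : ℝ) + 1) :=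
    ⟨_, rfl⟩
  have hb : ∀ i : Fin (k + 1), ∃ b : ContDiffBump (x i), b.rIn = d / 4 ∧ b.rOut = d / 2 :=
    fun i => ⟨⟨d / 4, d / 2, by positivity, by linarith⟩, rfl, rfl⟩
  choose b hbIn hbOut using hb
  refine ⟨fun i t => (((b i) t : ℝ) : ℂ), fun i => ⟨?_, ?_⟩, ?_⟩
  · exact ⟨Complex.ofRealCLM.contDiff.comp (b i).contDiff,
      (b i).hasCompactSupport.comp_left Complex.ofReal_zero⟩
  · refine (tsupport_comp_subset Complex.ofReal_zero _).trans ?_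
    rw [(b i).tsupport_eq, hbOut, Real.closedBall_eq_Icc]
    have hi : (((i : ℕ) : ℝ) + 1) ≤ (k : ℝ) + 1 := by
      have := i.is_lt
      exact_mod_cast this
    have h0 : (0 : ℝ) ≤ ((i : ℕ) : ℝ) := by positivity
    have hxi : x i = d * (((i : ℕ) : ℝ) + 1) := by rw [hx]
    refine Icc_subset_Icc ?_ ?_
    · rw [hxi]; nlinarith
    · rw [hxi]; nlinarith
  · rw [Fintype.linearIndependent_iff]
    intro c hc j
    have hj := congr_fun hc (x j)
    simp only [Finset.sum_apply, Pi.smul_apply, smul_eq_mul, Pi.zero_apply] at hj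
    rw [Finset.sum_eq_single j ?_ (by simp)] at hj
    · have h1 : (b j) (x j) = 1 :=
        (b j).one_of_mem_closedBall (Metric.mem_closedBall_self (by rw [hbIn]; positivity))
      rw [h1] at hj
      simpa using hj
    · intro i _ hij
      have hne : (i : ℕ) ≠ (j : ℕ) := fun h => hij (Fin.ext h)
      have hdist : (b i).rOut ≤ dist (x j) (x i) := by
        rw [hbOut, Real.dist_eq, hx]
        show d / 2 ≤ |d * (((j : ℕ) : ℝ) + 1) - d * (((i : ℕ) : ℝ) + 1)|
        rcases lt_or_gt_of_ne hne with h | h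
        · have h' : ((i : ℕ) : ℝ) + 1 ≤ ((j : ℕ) : ℝ) := by exact_mod_cast h
          rw [abs_of_nonneg (by nlinarith)]
          nlinarith
        · have h' : ((j : ℕ) : ℝ) + 1 ≤ ((i : ℕ) : ℝ) := by exact_mod_cast h
          rw [abs_of_nonpos (by nlinarith)]
          nlinarith
      rw [(b i).zero_of_le_dist hdist]
      simp

/-! ## `csInf` bookkeeping for the levels -/

/-- Admissible tuples bound the level from above: `level a k ≤ sSup Inner(g)`. [folklore] -/
theorem stub_branchesContinuous_level_le {k : ℕ} {a : ℝ} {g : Fin (k + 1) → ℝ → ℂ}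
    (hg : ∀ i, IsWeilTest (g i) ∧ tsupport (g i) ⊆ Set.Icc (-a) a)
    (hli : LinearIndependent ℂ g) :
    sInf {x : ℝ | ∃ g : Fin (k + 1) → ℝ → ℂ,
        (∀ i, IsWeilTest (g i) ∧ tsupport (g i) ⊆ Set.Icc (-a) a) ∧ LinearIndependent ℂ g ∧
        x = sSup {y : ℝ | ∃ c : Fin (k + 1) → ℂ,
          ∫ t, ‖∑ i, c i * g i t‖ ^ 2 = (1 : ℝ) ∧
          y = (weilQuadratic (fun t => ∑ i, c i * g i t)).re}} ≤
      sSup {y : ℝ | ∃ c : Fin (k + 1) → ℂ,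
          ∫ t, ‖∑ i, c i * g i t‖ ^ 2 = (1 : ℝ) ∧
          y = (weilQuadratic (fun t => ∑ i, c i * g i t)).re} :=
  csInf_le (stub_branchesContinuous_outer_bddBelow k a) ⟨g, hg, hli, rfl⟩

/-- A bound valid for every admissible tuple of a window `a > 0` bounds the level from below
(`Outer(a, k)` is nonempty). [folklore] -/
theorem stub_branchesContinuous_le_level {k : ℕ} {a b : ℝ} (ha : 0 < a)
    (hb : ∀ g : Fin (k + 1) → ℝ → ℂ,
      (∀ i, IsWeilTest (g i) ∧ tsupport (g i) ⊆ Set.Icc (-a) a) → LinearIndependent ℂ g →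
        b ≤ sSup {y : ℝ | ∃ c : Fin (k + 1) → ℂ,
          ∫ t, ‖∑ i, c i * g i t‖ ^ 2 = (1 : ℝ) ∧
          y = (weilQuadratic (fun t => ∑ i, c i * g i t)).re}) :
    b ≤ sInf {x : ℝ | ∃ g : Fin (k + 1) → ℝ → ℂ,
        (∀ i, IsWeilTest (g i) ∧ tsupport (g i) ⊆ Set.Icc (-a) a) ∧ LinearIndependent ℂ g ∧
        x = sSup {y : ℝ | ∃ c : Fin (k + 1) → ℂ,
          ∫ t, ‖∑ i, c i * g i t‖ ^ 2 = (1 : ℝ) ∧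
          y = (weilQuadratic (fun t => ∑ i, c i * g i t)).re}} := by
  obtain ⟨g, hg, hli⟩ := stub_branchesContinuous_exists_linearIndependent ha k
  refine le_csInf ⟨_, g, hg, hli, rfl⟩ ?_
  rintro x ⟨g', hg', hli', rfl⟩
  exact hb g' hg' hli'

/-- Near-optimal trial spaces exist: for `a > 0` and `ε > 0` some admissible tuple has
`sSup Inner(g) < level a k + ε`. [folklore] -/
theorem stub_branchesContinuous_exists_lt {k : ℕ} {a ε : ℝ} (ha : 0 < a) (hε : 0 < ε) :
    ∃ g : Fin (k + 1) → ℝ → ℂ,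
      (∀ i, IsWeilTest (g i) ∧ tsupport (g i) ⊆ Set.Icc (-a) a) ∧ LinearIndependent ℂ g ∧
      sSup {y : ℝ | ∃ c : Fin (k + 1) → ℂ,
          ∫ t, ‖∑ i, c i * g i t‖ ^ 2 = (1 : ℝ) ∧
          y = (weilQuadratic (fun t => ∑ i, c i * g i t)).re} <
        sInf {x : ℝ | ∃ g : Fin (k + 1) → ℝ → ℂ,
          (∀ i, IsWeilTest (g i) ∧ tsupport (g i) ⊆ Set.Icc (-a) a) ∧ LinearIndependent ℂ g ∧
          x = sSup {y : ℝ | ∃ c : Fin (k + 1) → ℂ,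
            ∫ t, ‖∑ i, c i * g i t‖ ^ 2 = (1 : ℝ) ∧
            y = (weilQuadratic (fun t => ∑ i, c i * g i t)).re}} + ε := by
  obtain ⟨g₁, hg₁, hli₁⟩ := stub_branchesContinuous_exists_linearIndependent ha k
  obtain ⟨x, ⟨g, hg, hli, rfl⟩, hlt⟩ := exists_lt_of_csInf_lt
    (s := {x : ℝ | ∃ g : Fin (k + 1) → ℝ → ℂ,
          (∀ i, IsWeilTest (g i) ∧ tsupport (g i) ⊆ Set.Icc (-a) a) ∧ LinearIndependent ℂ g ∧
          x = sSup {y : ℝ | ∃ c : Fin (k + 1) → ℂ,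
            ∫ t, ‖∑ i, c i * g i t‖ ^ 2 = (1 : ℝ) ∧
            y = (weilQuadratic (fun t => ∑ i, c i * g i t)).re}})
    ⟨_, g₁, hg₁, hli₁, rfl⟩ (lt_add_of_pos_right _ hε)
  exact ⟨g, hg, hli, hlt⟩

/-! ## Transfer of `sSup Inner` under the dilation -/

/-- **Dilation transfer.** If `|Re Q(f_η) − Re Q(f)| ≤ ε` for every normalised test function `f`
on the window `[-a, a]` with `Re Q(f) ≤ E` (the uniform modulus `exists_weilDilate_modulus`),
then for every linearly independent tuple `g` of window-`a` test functions with
`sSup Inner(g) ≤ E` the dilated tuple satisfies `sSup Inner(g_η) ≤ sSup Inner(g) + ε`: every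
unit combination of `g_η` is the dilate of a unit combination of `g`. [folklore] -/
theorem stub_branchesContinuous_sSup_dilate_le {k : ℕ} {g : Fin (k + 1) → ℝ → ℂ}
    {a E ε η : ℝ} (hg : ∀ i, IsWeilTest (g i) ∧ tsupport (g i) ⊆ Set.Icc (-a) a)
    (hli : LinearIndependent ℂ g) (hη : -1 < η)
    (hmod : ∀ f : ℝ → ℂ, IsWeilTest f → tsupport f ⊆ Icc (-a) a →
      ∫ t : ℝ, ‖f t‖ ^ 2 = (1 : ℝ) → (weilQuadratic f).re ≤ E →
        |(weilQuadratic (weilDilate η f)).re - (weilQuadratic f).re| ≤ ε)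
    (hE : sSup {y : ℝ | ∃ c : Fin (k + 1) → ℂ,
          ∫ t, ‖∑ i, c i * g i t‖ ^ 2 = (1 : ℝ) ∧
          y = (weilQuadratic (fun t => ∑ i, c i * g i t)).re} ≤ E) :
    sSup {y : ℝ | ∃ c : Fin (k + 1) → ℂ,
          ∫ t, ‖∑ i, c i * weilDilate η (g i) t‖ ^ 2 = (1 : ℝ) ∧
          y = (weilQuadratic (fun t => ∑ i, c i * weilDilate η (g i) t)).re} ≤
      sSup {y : ℝ | ∃ c : Fin (k + 1) → ℂ,
          ∫ t, ‖∑ i, c i * g i t‖ ^ 2 = (1 : ℝ) ∧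
          y = (weilQuadratic (fun t => ∑ i, c i * g i t)).re} + ε := by
  have hg1 : ∀ i, IsWeilTest (g i) := fun i => (hg i).1
  have hg' : ∀ i, IsWeilTest (weilDilate η (g i)) := fun i => (hg1 i).weilDilate hη
  have hli' : LinearIndependent ℂ (fun i => weilDilate η (g i)) :=
    stub_branchesContinuous_linearIndependent_weilDilate hη hli
  refine stub_branchesContinuous_sSup_le hg' hli' fun c hc => ?_
  have hf : IsWeilTest (fun t => ∑ i, c i * g i t) :=
    stub_branchesContinuous_isWeilTest_comb _ c fun i _ => hg1 i
  have hfs : tsupport (fun t => ∑ i, c i * g i t) ⊆ Icc (-a) a :=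
    stub_branchesContinuous_tsupport_comb_subset _ c fun i _ => (hg i).2
  have hc' : ∫ t, ‖weilDilate η (fun t => ∑ i, c i * g i t) t‖ ^ 2 = (1 : ℝ) := by
    rw [stub_branchesContinuous_weilDilate_comb]
    exact hc
  rw [integral_norm_sq_weilDilate _ hη] at hc'
  have hQ := stub_branchesContinuous_re_le_sSup hg1 hli hc'
  have hkey := hmod _ hf hfs hc' (hQ.trans hE)
  rw [stub_branchesContinuous_weilDilate_comb, abs_le] at hkey
  linarith [hkey.2]

end Summit.RiemannHypothesis.RiemannHypothesis.Theorems.RuelleBandCofiniteCriticalLine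

end
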